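import Summits.RiemannHypothesis.RiemannHypothesis.Theorems.HandoffDodgerWitness
import Summits.RiemannHypothesis.RiemannHypothesis.Theorems.HandoffDodgerHorizonChoice
import HarnessLib

/-!
# HANDOFF — the dodger witness with EVERY non-explicit quantity eliminated (rh-explicit, track «HANDOFF», seat prove-2 gen10, ATTEMPT-19 §8)

HONEST FRAMING. Nothing here bears on the truth of RH; this is monotonicity bookkeeping. `HandoffDodgerWitness.dodger_witness` gives the
`(q, q′)` clause of `SubwindowZeroSumFamily C` from hypotheses involving the killed count `K = N(T′)`, the deficit integral `∫₀^{T′}t·D`,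
the first power sum `p₁ = Re S_1` and the shift `δ`. Here `T′ = πk′/b` is the horizon of `HandoffDodgerHorizonChoice` (`T₀ = 2πe^{1+2b}`,
`s = (0.1038 * Real.log (T₀) + 0.2573 * Real.log (Real.log (T₀)) + 9.3675)`), `δ := y/√p₁`, `N₂ := ⌊p₁/(2W)⌋`, `W = T′² + ¼`, and the free parameters of the profile lemma are instantiated by EXPLICIT upper
bounds (`η ≤ η⁺`, `λ ≤ λ⁺`, `ρ₂ ≤ ρ₂⁺ = 8e²W³y²/p₋³`, `τ₂ ≤ τ₂⁺` — NO upper bound on `p₁` enters except the trivial `p₁ ≤ k′W` in `δ ≥ y/√(k′W)`),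
so that **`dodger_witness_explicit`** has only EXPLICIT real hypotheses in `(q, q′, b, k′, n, N₁, y, C)` plus the generic-window hypothesis.
Its cost side uses `N(x) ≤ x log x` (`x ≥ 16`, from HSW), the antitonicity of `log x/x` and `(log x + 1)/x`, and `K − 1 ≤ k′`;
its gain side uses `δ ≥ y/√(k′W) ≥ 6r` and `p₁(3(δ−3r)/4)² ≥ 9y²/64`. No `sorry`, standard axioms, no definitions.

References: this track (ATTEMPT-16 §6; ATTEMPT-19 §8).
-/

set_option linter.dupNamespace false

noncomputable section

open Real Set MeasureTheory

namespace Summit.RiemannHypothesis.RiemannHypothesis.Theorems.Handoff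

open Literature.NumberTheory.LFunctions Literature.NumberTheory.LFunctions.SchoenfeldBound
  Literature.NumberTheory.LFunctions.KadiriTail Literature.NumberTheory.LFunctions.WeilContinuous


/-! ## Small real-analysis facts -/

set_option maxHeartbeats 400000 in
/-- **THE DODGER WITNESS WITH EXPLICIT HYPOTHESES.** All of `K = N(T′)`, `∫tD`, `p₁`, `δ`, `N₂` eliminated; see the module docstring and
ATTEMPT-19 §8 for the dictionary. [this track, ATTEMPT-16 §6 THEOREM 16.1/16.2; ATTEMPT-19 §8] -/
theorem dodger_witness_explicit {q q' : ℕ} {b T₀ y C : ℝ} {n k' N₁ : ℕ}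
    {W cI pL pU cL xL δU δL ηU lamU ρ1 ρ2U τ1 τ2U κ : ℝ}
    -- the horizon (ATTEMPT-16 §1 / HorizonChoice)
    (hb : 1 ≤ b) (hT₀ : T₀ = 2 * π * Real.exp (1 + 2 * b))
    (hT2h : T₀ ≤ 11 / 10 * (T₀ - 4 * π * ((0.1038 * Real.log (T₀) + 0.2573 * Real.log (Real.log (T₀)) + 9.3675) + 2)))
    (hQ1b : (0.1038 * Real.log (T₀) + 0.2573 * Real.log (Real.log (T₀)) + 9.3675) + 1 ≤ 14 / (2 * π) * Real.log (T₀ / 14))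
    (hk'T : π * k' / b ≤ T₀ - 4 * π * ((0.1038 * Real.log (T₀) + 0.2573 * Real.log (Real.log (T₀)) + 9.3675) + 2)) (hk'ge : T₀ - 4 * π * ((0.1038 * Real.log (T₀) + 0.2573 * Real.log (Real.log (T₀)) + 9.3675) + 2) - π / b ≤ π * k' / b)
    (hT'3 : 3 ≤ π * k' / b) (hk'2 : 2 ≤ k')
    (hℓ2 : 2 ≤ π * k' / b - π * (3 * (0.1038 * Real.log (T₀) + 0.2573 * Real.log (Real.log (T₀)) + 9.3675) + 5) / b) (hK1 : 1 ≤ (k' : ℝ) - 3 * (0.1038 * Real.log (T₀) + 0.2573 * Real.log (Real.log (T₀)) + 9.3675) - 5)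
    -- the explicit derived quantities
    (hW : W = (π * k' / b) ^ 2 + 1 / 4)
    (hcI : cI = (π * k' / b - π * (3 * (0.1038 * Real.log (T₀) + 0.2573 * Real.log (Real.log (T₀)) + 9.3675) + 5) / b - 1) ^ 3 / (18 * π) - (Real.log T₀ + 1 / 3) / (6 * π) -
      ((0.1038 * Real.log (T₀) + 0.2573 * Real.log (Real.log (T₀)) + 9.3675) + 1) * (π * k' / b - 1) ^ 2 / 2)
    (hpL : pL = 2 * cI - k' / 4) (hpU : pU = k' * W) (hcL : cL = 4 * cI) (hxL : xL = Real.sqrt (cL / 4))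
    (hy : 0 < y) (hδU : δU = y / Real.sqrt pL) (hδL : δL = y / Real.sqrt pU)
    (hηU : ηU = Real.exp (2 * (1 / pL + k' * (π * k' / b + 1 / 2) / pL ^ 2) * W * (N₁ : ℝ) ^ 2) - 1)
    (hlamU : lamU = 1 + k' * (π * k' / b + 1 / 2) / pL)
    (hρ1 : ρ1 = Real.exp (3 + lamU) * (4 * y ^ 2) / (4 * ((N₁ : ℝ) + 1) ^ 3))
    (hρ2U : ρ2U = 8 * Real.exp 2 * W ^ 3 * y ^ 2 / pL ^ 3)
    (hτ1 : τ1 = ρ1 ^ (N₁ + 1) / (1 - ρ1))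
    (hτ2U : τ2U = Real.exp (pL / W * (1 + 1 / 2 * Real.log ρ2U) + k' * (π * k' / b + 1 / 2) / (2 * W)) / (1 - ρ2U))
    (hκdef : κ = 1 - ηU - 3 * τ1 - τ2U)
    -- the explicit conditions
    (hc : 1024 ≤ cL) (hp : 0 < pL) (hN : (N₁ : ℝ) + 1 ≤ pL / (2 * W))
    (hρ11 : ρ1 < 1) (hρ2e : ρ2U ≤ Real.exp (-2)) (hκ : 0 ≤ κ)
    (hδb : δU ≤ b) (hr6 : 6 * (bump n).rOut ≤ δL)
    (hδC : δU ≤ C * Real.log q ^ (3 / 2 : ℝ) * (q : ℝ) ^ (-(3 / 2 : ℝ))) (hwin : Real.log q / 2 + δU ≤ Real.log q' / 2)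
    (hbq1 : b + (bump n).rOut ≤ Real.log q / 2) (hbq2 : Real.log q / 2 ≤ b + 2 * (bump n).rOut)
    (hgen : ∀ ρ : ℂ, riemannZeta ρ = 0 → 0 < ρ.im →
      ∀ k ∈ Finset.range (zetaZeroCount (π * k' / b)), dodgerNode ρ - latticeFreq b (k + 1) ≠ 0)
    -- the ONE comparison (cost prefactor · explicit bracket < (2 log q/√q) · explicit gain), `c_∞`-free
    (hlt : 2 * (4 * (Real.sinh (δU / 2) ^ 2 + 1) * Real.exp 1 * (4 * Real.cosh (b / 2) ^ 2 * (1 + b) ^ 2 / b ^ 2)) *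
        (((2 * (π * k' / b)) / (2 * π) * Real.log ((2 * (π * k' / b)) / (2 * π * Real.exp 1)) + (0.1038 * Real.log (2 * (π * k' / b)) + 0.2573 * Real.log (Real.log (2 * (π * k' / b))) + 9.3675)) /
            (π * k' / b) ^ 2 * Real.exp (4 * (b / π * (1 + Real.log ((k' : ℝ) - 1))) - cL / (2 * (π * k' / b) + 1) ^ 2) +
          Real.exp (144 * (2 * (k' : ℝ)) ^ 2 / (7 * cL)) * (Real.log xL / (Real.exp 1 * xL) + 220 * (Real.log xL + 1) / xL)) <
      2 * Real.log q / Real.sqrt q * ((δL - 3 * (bump n).rOut) / 2 * (κ ^ 2 / (4 * b ^ 2)) * dodgerPhi (9 * y ^ 2 / 64) ^ 2)) :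
    ∃ θ : ℝ → ℂ, ∃ δ' B : ℝ, IsWeilTest θ ∧ tsupport θ ⊆ Icc (-(Real.log q / 2)) (Real.log q / 2) ∧ 0 ≤ δ' ∧
      δ' ≤ C * Real.log q ^ (3 / 2 : ℝ) * (q : ℝ) ^ (-(3 / 2 : ℝ)) ∧ Real.log q / 2 + δ' ≤ Real.log q' / 2 ∧
      (∀ U : ℝ, ∑ᶠ ρ ∈ weilZeroIndex U,
          (riemannZetaZeroOrder ρ : ℝ) * ‖weilMellin (fun x ↦ θ (x - δ') - θ (x + δ')) ρ‖ ^ 2 ≤ B) ∧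
      B < 2 * Real.log q / Real.sqrt q * (weilConv θ (weilReflect θ) (Real.log q - 2 * δ')).re := by
  have hπ := Real.pi_pos
  have hπ3 := Real.pi_gt_three
  have hb0 : 0 < b := by linarith
  obtain ⟨hT₀e, hT₀pos, hlogT₀, hllT₀, hs1, -⟩ := horizonT₀_facts hb hT₀
  have hr0 : 0 < (bump n).rOut := (bump n).rOut_pos
  have hT'0 : 0 < π * k' / b := by linarith
  have hW0 : 0 < W := by rw [hW]; positivity
  have h4π : 0 ≤ 4 * π * ((0.1038 * Real.log (T₀) + 0.2573 * Real.log (Real.log (T₀)) + 9.3675) + 2) := by positivity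
  -- (1) the clean horizon
  obtain ⟨hKle, hDc, hD0, hΔ⟩ := horizon_package (Tstar := T₀ - 4 * π * ((0.1038 * Real.log (T₀) + 0.2573 * Real.log (Real.log (T₀)) + 9.3675) + 2)) hb hT₀ le_rfl hT2h hQ1b hk'T
  -- (2) `k′ − 3s − 5 ≤ K ≤ k′`
  have hKk : (zetaZeroCount (π * k' / b) : ℝ) ≤ k' := zetaZeroCount_horizon_le hb0 hKle
  have hKlow : (k' : ℝ) - 3 * (0.1038 * Real.log (T₀) + 0.2573 * Real.log (Real.log (T₀)) + 9.3675) - 5 ≤ (zetaZeroCount (π * k' / b) : ℝ) :=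
    zetaZeroCount_horizon_ge hb hT₀ (by have := Real.exp_one_lt_d9; linarith) (by linarith) (by linarith)
  -- (3) the deficit integral, (4) the power sum
  have hcI_le := deficitIntegral_ge hb hT₀ hKle hKlow hℓ2 (by linarith)
  rw [← hcI] at hcI_le
  obtain ⟨hp1, hp2⟩ := re_dodgerPowerSum_one_bounds hb hKle hDc hΔ
  -- abbreviations (after the lemma outputs, so that they are rewritten consistently)
  set r : ℝ := (bump n).rOut with hr
  set T' : ℝ := π * k' / b with hT'
  set K : ℕ := zetaZeroCount T' with hKdef
  set c : ℝ := 4 * ∫ t in (0 : ℝ)..T', t * (max 0 (T₀ / (2 * π) * negMulLog (t / T₀) - (0.1038 * Real.log (T₀) + 0.2573 * Real.log (Real.log (T₀)) + 9.3675) - 1) *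
    max 0 (min 1 (π * K / b - t))) with hcdef
  set p : ℝ := (dodgerPowerSum b T' 1).re with hpdef
  have hK1r : (1 : ℝ) ≤ K := hK1.trans hKlow
  have hK1 : 1 ≤ K := by exact_mod_cast hK1r
  have hcLc : cL ≤ c := by rw [hcL, hcdef]; linarith
  have hc64 : 64 ≤ c := by linarith
  have hcL0 : 0 < cL := by linarith
  have hc0 : 0 < c := by linarith
  have hpLp : pL ≤ p := by rw [hpL]; linarith
  have hppU : p ≤ pU := by rw [hpU, hW]; exact hp2
  have hp0 : 0 < p := lt_of_lt_of_le hp hpLp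
  have hpU0 : 0 < pU := lt_of_lt_of_le hp0 hppU
  -- (5) the shift `δ = y/√p₁`
  set δ : ℝ := y / Real.sqrt p with hδ
  have hsp : 0 < Real.sqrt p := Real.sqrt_pos.2 hp0
  have hδ0 : 0 < δ := by positivity
  have hδδU : δ ≤ δU := by
    rw [hδ, hδU]; exact div_le_div_of_nonneg_left hy.le (Real.sqrt_pos.2 hp) (Real.sqrt_le_sqrt hpLp)
  have hδLδ : δL ≤ δ := by
    rw [hδ, hδL]; exact div_le_div_of_nonneg_left hy.le hsp (Real.sqrt_le_sqrt hppU)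
  have hpδ : p * δ ^ 2 = y ^ 2 := by
    rw [hδ, div_pow, Real.sq_sqrt hp0.le]; field_simp
  -- (6) `N₂ = ⌊p/(2W)⌋`
  set N₂ : ℕ := ⌊p / (2 * W)⌋₊ with hN₂
  have hN₂le : (N₂ : ℝ) ≤ p / (2 * W) := Nat.floor_le (by positivity)
  have hN₂ge : p / (2 * W) ≤ (N₂ : ℝ) + 1 := (Nat.lt_floor_add_one _).le
  have hWN : W * N₂ ≤ p / 2 := by
    have := mul_le_mul_of_nonneg_left hN₂le hW0.le
    rw [mul_div_assoc', mul_comm W p, mul_div_mul_comm, div_self hW0.ne', mul_one] at this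
    linarith
  have hN12 : N₁ ≤ N₂ := by
    have h1 : (N₁ : ℝ) + 1 ≤ (N₂ : ℝ) + 1 :=
      hN.trans ((div_le_div_of_nonneg_right hpLp (by positivity)).trans hN₂ge)
    exact_mod_cast (by linarith : (N₁ : ℝ) ≤ N₂)
  -- forget the values of the abbreviations (keeping their defining equations): keeps the context light for `linarith`
  clear_value N₂ δ p c K T' r
  have hT'h : (0 : ℝ) ≤ T' + 1 / 2 := by linarith only [hT'0]
  have hKnn : (0 : ℝ) ≤ K := Nat.cast_nonneg K
  -- (7) the profile parameters
  have hX : p * (2 * δ) ^ 2 ≤ 4 * y ^ 2 := by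
    have e : p * (2 * δ) ^ 2 = 4 * (p * δ ^ 2) := by ring
    rw [e, hpδ]
  have hKT : (K : ℝ) * (T' + 1 / 2) ≤ k' * (T' + 1 / 2) := mul_le_mul_of_nonneg_right hKk hT'h
  have hKT0 : (0 : ℝ) ≤ (K : ℝ) * (T' + 1 / 2) := mul_nonneg hKnn hT'h
  have hη : Real.exp (2 * (p + (K : ℝ) * (T' + 1 / 2)) * W * (N₁ : ℝ) ^ 2 / p ^ 2) - 1 ≤ ηU := by
    rw [hηU]
    have e1 : 1 / p = p / p ^ 2 := by
      rw [eq_div_iff (pow_ne_zero 2 hp0.ne'), sq, one_div, inv_mul_cancel_left₀ hp0.ne']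
    have e : 2 * (p + (K : ℝ) * (T' + 1 / 2)) * W * (N₁ : ℝ) ^ 2 / p ^ 2 =
        (1 / p + (K : ℝ) * (T' + 1 / 2) / p ^ 2) * (2 * W * (N₁ : ℝ) ^ 2) := by
      rw [e1, ← add_div]; ring
    have e' : 2 * (1 / pL + k' * (T' + 1 / 2) / pL ^ 2) * W * (N₁ : ℝ) ^ 2 =
        (1 / pL + k' * (T' + 1 / 2) / pL ^ 2) * (2 * W * (N₁ : ℝ) ^ 2) := by ring
    have h1 : 1 / p ≤ 1 / pL := div_le_div_of_nonneg_left zero_le_one hp hpLp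
    have h2 : (K : ℝ) * (T' + 1 / 2) / p ^ 2 ≤ k' * (T' + 1 / 2) / pL ^ 2 := by
      refine le_trans (div_le_div_of_nonneg_right hKT (by positivity)) ?_
      exact div_le_div_of_nonneg_left (by positivity) (by positivity) (pow_le_pow_left₀ hp.le hpLp 2)
    have h3 : (1 / p + (K : ℝ) * (T' + 1 / 2) / p ^ 2) * (2 * W * (N₁ : ℝ) ^ 2) ≤
        (1 / pL + k' * (T' + 1 / 2) / pL ^ 2) * (2 * W * (N₁ : ℝ) ^ 2) :=
      mul_le_mul_of_nonneg_right (add_le_add h1 h2) (by positivity)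
    rw [e, e']
    linarith only [Real.exp_le_exp.2 h3]
  have hlam : 2 * (p + (K : ℝ) * (T' + 1 / 2)) * W * (N₂ : ℝ) / p ^ 2 ≤ lamU := by
    rw [hlamU]
    have hA0 : 0 ≤ 2 * (p + (K : ℝ) * (T' + 1 / 2)) := by linarith only [hp0, hKT0]
    have h1 : 2 * (p + (K : ℝ) * (T' + 1 / 2)) * W * (N₂ : ℝ) / p ^ 2 ≤
        2 * (p + (K : ℝ) * (T' + 1 / 2)) * (p / 2) / p ^ 2 := by
      refine div_le_div_of_nonneg_right ?_ (by positivity)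
      calc 2 * (p + (K : ℝ) * (T' + 1 / 2)) * W * (N₂ : ℝ) = 2 * (p + (K : ℝ) * (T' + 1 / 2)) * (W * N₂) := by ring
        _ ≤ 2 * (p + (K : ℝ) * (T' + 1 / 2)) * (p / 2) := mul_le_mul_of_nonneg_left hWN hA0
    have h2 : 2 * (p + (K : ℝ) * (T' + 1 / 2)) * (p / 2) / p ^ 2 = 1 + (K : ℝ) * (T' + 1 / 2) / p := by
      rw [sq, show 2 * (p + (K : ℝ) * (T' + 1 / 2)) * (p / 2) = (p + (K : ℝ) * (T' + 1 / 2)) * p by ring,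
        mul_div_mul_right _ _ hp0.ne', add_div, div_self hp0.ne']
    have h3 : (K : ℝ) * (T' + 1 / 2) / p ≤ k' * (T' + 1 / 2) / pL :=
      (div_le_div_of_nonneg_right hKT hp0.le).trans (div_le_div_of_nonneg_left (mul_nonneg (Nat.cast_nonneg _) hT'h) hp hpLp)
    linarith only [h1, h2, h3]
  have hρ1' : Real.exp (3 + lamU) * (4 * y ^ 2) / (4 * ((N₁ : ℝ) + 1) ^ 3) ≤ ρ1 := by rw [hρ1]
  have hρ2 : Real.exp 2 * W * (2 * δ) ^ 2 / (2 * ((N₂ : ℝ) + 1) ^ 2) ≤ ρ2U := by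
    rw [hρ2U]
    have h1 : (2 * δ) ^ 2 = 4 * y ^ 2 / p := by
      rw [mul_pow, ← hpδ, show (4 : ℝ) * (p * δ ^ 2) / p = 4 * δ ^ 2 * (p / p) by ring, div_self hp0.ne']
      norm_num
    have hq0 : 0 < p / (2 * W) := by positivity
    have h2 : (p / (2 * W)) ^ 2 ≤ ((N₂ : ℝ) + 1) ^ 2 := pow_le_pow_left₀ hq0.le hN₂ge 2
    rw [h1]
    calc Real.exp 2 * W * (4 * y ^ 2 / p) / (2 * ((N₂ : ℝ) + 1) ^ 2)
        ≤ Real.exp 2 * W * (4 * y ^ 2 / p) / (2 * (p / (2 * W)) ^ 2) := by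
          apply div_le_div_of_nonneg_left (by positivity) (by positivity)
          exact mul_le_mul_of_nonneg_left h2 (by norm_num)
      _ = 8 * Real.exp 2 * W ^ 3 * y ^ 2 / p ^ 3 := by field_simp; ring
      _ ≤ 8 * Real.exp 2 * W ^ 3 * y ^ 2 / pL ^ 3 :=
          div_le_div_of_nonneg_left (by positivity) (by positivity) (pow_le_pow_left₀ hp.le hpLp 3)
  have hρ2U0 : 0 < ρ2U := by rw [hρ2U]; positivity
  have hρ2U1 : ρ2U < 1 := by
    have h := Real.exp_lt_exp.2 (by norm_num : (-2 : ℝ) < 0)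
    rw [Real.exp_zero] at h
    exact lt_of_le_of_lt hρ2e h
  have hlogρ : 1 + 1 / 2 * Real.log ρ2U ≤ 0 := by
    have := Real.log_le_log hρ2U0 hρ2e
    rw [Real.log_exp] at this
    linarith only [this]
  have hτ1' : ρ1 ^ (N₁ + 1) / (1 - ρ1) ≤ τ1 := by rw [hτ1]
  have hτ2 : Real.exp ((p + (p + (K : ℝ) * (T' + 1 / 2))) / (2 * W)) * ρ2U ^ (N₂ + 1) / (1 - ρ2U) ≤ τ2U := by
    rw [hτ2U]
    refine div_le_div_of_nonneg_right ?_ (by linarith only [hρ2U1])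
    -- `ρ₂⁺^{N₂+1} ≤ ρ₂⁺^{p/(2W)} = exp((p/(2W)) log ρ₂⁺)`
    have h1 : ρ2U ^ (N₂ + 1) ≤ Real.exp (p / (2 * W) * Real.log ρ2U) := by
      have e : ρ2U ^ (N₂ + 1) = Real.exp (((N₂ : ℝ) + 1) * Real.log ρ2U) := by
        rw [← Real.rpow_natCast, Real.rpow_def_of_pos hρ2U0]; push_cast; ring_nf
      rw [e]
      apply Real.exp_le_exp.2
      have hlog0 : Real.log ρ2U ≤ 0 := Real.log_nonpos hρ2U0.le hρ2U1.le
      nlinarith only [hlog0, hN₂ge]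
    calc Real.exp ((p + (p + (K : ℝ) * (T' + 1 / 2))) / (2 * W)) * ρ2U ^ (N₂ + 1)
        ≤ Real.exp ((p + (p + (K : ℝ) * (T' + 1 / 2))) / (2 * W)) * Real.exp (p / (2 * W) * Real.log ρ2U) :=
          mul_le_mul_of_nonneg_left h1 (Real.exp_pos _).le
      _ = Real.exp (p / W * (1 + 1 / 2 * Real.log ρ2U) + (K : ℝ) * (T' + 1 / 2) / (2 * W)) := by
          rw [← Real.exp_add]; congr 1; ring
      _ ≤ Real.exp (pL / W * (1 + 1 / 2 * Real.log ρ2U) + k' * (T' + 1 / 2) / (2 * W)) := by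
          apply Real.exp_le_exp.2
          have ha : p / W * (1 + 1 / 2 * Real.log ρ2U) ≤ pL / W * (1 + 1 / 2 * Real.log ρ2U) := by
            have h := div_le_div_of_nonneg_right hpLp hW0.le
            exact mul_le_mul_of_nonpos_right h hlogρ
          have hb' : (K : ℝ) * (T' + 1 / 2) / (2 * W) ≤ k' * (T' + 1 / 2) / (2 * W) :=
            div_le_div_of_nonneg_right hKT (by positivity)
          linarith only [ha, hb']
  have hκ' : 0 ≤ 1 - ηU - 3 * τ1 - τ2U := by rw [← hκdef]; exact hκ
  -- (8) the window conditions for `δ`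
  have hδb' : δ ≤ b := hδδU.trans hδb
  have hεδ : 3 * r ≤ δ := by linarith only [hr6, hδLδ, hr0]
  have hδC' : δ ≤ C * Real.log q ^ (3 / 2 : ℝ) * (q : ℝ) ^ (-(3 / 2 : ℝ)) := hδδU.trans hδC
  have hwin' : Real.log q / 2 + δ ≤ Real.log q' / 2 := by linarith only [hwin, hδδU]
  -- (9) the comparison: cost ≤ c_∞²·(explicit) and gain ≥ c_∞²·(explicit)
  set cR : ℝ := (∏ k ∈ Finset.range (zetaZeroCount T'), (latticeFreq b (k + 1)) ^ 2) /
      ∏ ρ ∈ zerosBetween 0 T', ‖dodgerNode ρ‖ ^ (2 * (riemannZetaZeroOrder ρ).toNat) with hcR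
  have hcR0 : 0 < cR := by
    have h1 : 0 < ∏ k ∈ Finset.range (zetaZeroCount T'), (latticeFreq b (k + 1)) ^ 2 :=
      Finset.prod_pos fun k _ => by unfold latticeFreq; positivity
    exact div_pos h1 (prod_norm_dodgerNode_pow_pos T')
  clear_value cR
  -- the explicit bracket bounds the true bracket
  have hxL16 : 16 ≤ xL := by
    rw [hxL]
    have : Real.sqrt (16 ^ 2) ≤ Real.sqrt (cL / 4) := Real.sqrt_le_sqrt (by linarith only [hc])
    rwa [Real.sqrt_sq (by norm_num)] at this
  have hxL0 : 0 < xL := by linarith only [hxL16]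
  have hxLx : xL ≤ Real.sqrt (c / 4) := by rw [hxL]; exact Real.sqrt_le_sqrt (by linarith only [hcLc])
  have hx16 : 16 ≤ Real.sqrt (c / 4) := hxL16.trans hxLx
  have htb0 : 0 ≤ tailBound |(0 : ℝ)| (Real.sqrt (c / 4)) := tailBound_nonneg (abs_nonneg _) (by linarith only [hx16])
  have hK1' : ((zetaZeroCount T' - 1 : ℕ) : ℝ) ≤ (k' : ℝ) - 1 := by
    have : ((zetaZeroCount T' - 1 : ℕ) : ℝ) = (K : ℝ) - 1 := by
      rw [hKdef]; exact_mod_cast Nat.cast_sub (hKdef ▸ hK1)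
    rw [this]; linarith only [hKk]
  have hK0' : (0 : ℝ) ≤ ((zetaZeroCount T' - 1 : ℕ) : ℝ) := Nat.cast_nonneg _
  -- near term
  have hN2T : (zetaZeroCount (2 * T') : ℝ) ≤ (2 * T') / (2 * π) * Real.log ((2 * T') / (2 * π * Real.exp 1)) + (0.1038 * Real.log (2 * T') + 0.2573 * Real.log (Real.log (2 * T')) + 9.3675) := by
    have he : Real.exp 1 ≤ 2 * T' := by have := Real.exp_one_lt_d9; linarith only [this, hT'3, hT'0]
    have := (abs_le.1 (zetaZeroCount_hasanalizade_shen_wong_holds (2 * T') he)).2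
    linarith only [this]
  have hlogK : Real.log ((zetaZeroCount T' - 1 : ℕ) : ℝ) ≤ Real.log ((k' : ℝ) - 1) := by
    have hk2r : (2 : ℝ) ≤ k' := by exact_mod_cast hk'2
    rcases eq_or_lt_of_le hK0' with h0 | hpos
    · rw [← h0, Real.log_zero]
      exact Real.log_nonneg (by linarith only [hk2r])
    · exact Real.log_le_log hpos hK1'
  have hnear : (zetaZeroCount (2 * T') : ℝ) / T' ^ 2 *
        Real.exp (4 * (b / π * (1 + Real.log ((zetaZeroCount T' - 1 : ℕ) : ℝ))) - c / (2 * T' + 1) ^ 2) ≤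
      ((2 * T') / (2 * π) * Real.log ((2 * T') / (2 * π * Real.exp 1)) + (0.1038 * Real.log (2 * T') + 0.2573 * Real.log (Real.log (2 * T')) + 9.3675)) / T' ^ 2 *
        Real.exp (4 * (b / π * (1 + Real.log ((k' : ℝ) - 1))) - cL / (2 * T' + 1) ^ 2) := by
    refine mul_le_mul (div_le_div_of_nonneg_right hN2T (by positivity)) (Real.exp_le_exp.2 ?_) (Real.exp_pos _).le ?_
    · have hbπ : 0 ≤ b / π := by positivity
      have h1 := mul_le_mul_of_nonneg_left hlogK hbπ
      have h2 : cL / (2 * T' + 1) ^ 2 ≤ c / (2 * T' + 1) ^ 2 := div_le_div_of_nonneg_right hcLc (by positivity)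
      nlinarith only [h1, h2]
    · exact div_nonneg ((Nat.cast_nonneg _).trans hN2T) (by positivity)
  -- far term
  have hfar1 : Real.exp (144 * (2 * ((zetaZeroCount T' - 1 : ℕ) : ℝ)) ^ 2 / (7 * c)) ≤ Real.exp (144 * (2 * (k' : ℝ)) ^ 2 / (7 * cL)) := by
    apply Real.exp_le_exp.2
    have h1 : (2 * ((zetaZeroCount T' - 1 : ℕ) : ℝ)) ^ 2 ≤ (2 * (k' : ℝ)) ^ 2 :=
      pow_le_pow_left₀ (by positivity) (by linarith only [hK1']) 2
    calc 144 * (2 * ((zetaZeroCount T' - 1 : ℕ) : ℝ)) ^ 2 / (7 * c) ≤ 144 * (2 * (k' : ℝ)) ^ 2 / (7 * c) :=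
          div_le_div_of_nonneg_right (by nlinarith only [h1]) (by positivity)
      _ ≤ 144 * (2 * (k' : ℝ)) ^ 2 / (7 * cL) := div_le_div_of_nonneg_left (by positivity) (by positivity) (by linarith only [hcLc])
  have hxsq : Real.sqrt (c / 4) ^ 2 = c / 4 := Real.sq_sqrt (by linarith only [hc0])
  have hfar2 : (zetaZeroCount (Real.sqrt (c / 4)) : ℝ) / (Real.exp 1 * (c / 4)) ≤ Real.log xL / (Real.exp 1 * xL) := by
    have e0 : Real.exp 1 * (c / 4) = Real.exp 1 * Real.sqrt (c / 4) ^ 2 := by rw [hxsq]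
    rw [e0]
    have hx0 : 0 < Real.sqrt (c / 4) := by linarith only [hx16]
    have h1 : (zetaZeroCount (Real.sqrt (c / 4)) : ℝ) / (Real.exp 1 * Real.sqrt (c / 4) ^ 2) ≤
        Real.sqrt (c / 4) * Real.log (Real.sqrt (c / 4)) / (Real.exp 1 * Real.sqrt (c / 4) ^ 2) :=
      div_le_div_of_nonneg_right (zetaZeroCount_le_mul_log hx16) (by positivity)
    have h2 : Real.sqrt (c / 4) * Real.log (Real.sqrt (c / 4)) / (Real.exp 1 * Real.sqrt (c / 4) ^ 2) =
        Real.log (Real.sqrt (c / 4)) / Real.sqrt (c / 4) / Real.exp 1 := by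
      rw [div_div, div_eq_div_iff (by positivity) (by positivity)]; ring
    have h3 : Real.log xL / (Real.exp 1 * xL) = Real.log xL / xL / Real.exp 1 := by
      rw [div_div, div_eq_div_iff (by positivity) (by positivity)]; ring
    rw [h2] at h1
    rw [h3]
    have hexL : Real.exp 1 ≤ xL := by have := Real.exp_one_lt_d9; linarith only [this, hxL16]
    have h4 : Real.log (Real.sqrt (c / 4)) / Real.sqrt (c / 4) ≤ Real.log xL / xL :=
      Real.log_div_self_antitoneOn hexL (le_trans hexL hxLx) hxLx
    exact h1.trans (div_le_div_of_nonneg_right h4 (Real.exp_pos 1).le)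
  have hfar3 : tailBound |(0 : ℝ)| (Real.sqrt (c / 4)) ≤ 220 * (Real.log xL + 1) / xL := by
    refine (tailBound_zero_le (by linarith only [hc64] : (16 : ℝ) ≤ c / 4)).trans ?_
    rw [mul_div_assoc, mul_div_assoc]
    exact mul_le_mul_of_nonneg_left (log_add_one_div_anti (by linarith only [hxL16]) hxLx) (by norm_num)
  have hfar : Real.exp (144 * (2 * ((zetaZeroCount T' - 1 : ℕ) : ℝ)) ^ 2 / (7 * c)) *
        ((zetaZeroCount (Real.sqrt (c / 4)) : ℝ) / (Real.exp 1 * (c / 4)) + tailBound |(0 : ℝ)| (Real.sqrt (c / 4))) ≤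
      Real.exp (144 * (2 * (k' : ℝ)) ^ 2 / (7 * cL)) * (Real.log xL / (Real.exp 1 * xL) + 220 * (Real.log xL + 1) / xL) :=
    mul_le_mul hfar1 (add_le_add hfar2 hfar3) (add_nonneg (by positivity) htb0) (Real.exp_pos _).le
  have hBR0 : 0 ≤ (zetaZeroCount (2 * T') : ℝ) / T' ^ 2 *
        Real.exp (4 * (b / π * (1 + Real.log ((zetaZeroCount T' - 1 : ℕ) : ℝ))) - c / (2 * T' + 1) ^ 2) +
      Real.exp (144 * (2 * ((zetaZeroCount T' - 1 : ℕ) : ℝ)) ^ 2 / (7 * c)) *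
        ((zetaZeroCount (Real.sqrt (c / 4)) : ℝ) / (Real.exp 1 * (c / 4)) + tailBound |(0 : ℝ)| (Real.sqrt (c / 4))) :=
    add_nonneg (by positivity) (mul_nonneg (Real.exp_pos _).le (add_nonneg (by positivity) htb0))
  -- cost ≤ c_∞² · explicit
  have hsinh : Real.sinh (δ / 2) ^ 2 ≤ Real.sinh (δU / 2) ^ 2 := by
    have h0 : 0 ≤ Real.sinh (δ / 2) := Real.sinh_nonneg_iff.2 (by linarith only [hδ0])
    exact pow_le_pow_left₀ h0 (Real.sinh_le_sinh.2 (by linarith only [hδδU])) 2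
  have hpre : 0 ≤ 4 * Real.cosh (b / 2) ^ 2 * (1 + b) ^ 2 / b ^ 2 := by positivity
  have hcost : dodgerCostBound b T' δ c ≤
      cR ^ 2 * (2 * (4 * (Real.sinh (δU / 2) ^ 2 + 1) * Real.exp 1 * (4 * Real.cosh (b / 2) ^ 2 * (1 + b) ^ 2 / b ^ 2)) *
        (((2 * T') / (2 * π) * Real.log ((2 * T') / (2 * π * Real.exp 1)) + (0.1038 * Real.log (2 * T') + 0.2573 * Real.log (Real.log (2 * T')) + 9.3675)) / T' ^ 2 *
            Real.exp (4 * (b / π * (1 + Real.log ((k' : ℝ) - 1))) - cL / (2 * T' + 1) ^ 2) +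
          Real.exp (144 * (2 * (k' : ℝ)) ^ 2 / (7 * cL)) * (Real.log xL / (Real.exp 1 * xL) + 220 * (Real.log xL + 1) / xL))) := by
    unfold dodgerCostBound
    rw [← hcR]
    have hfac1 : 4 * (Real.sinh (δ / 2) ^ 2 + 1) * Real.exp 1 * cR ^ 2 * (4 * Real.cosh (b / 2) ^ 2 * (1 + b) ^ 2 / b ^ 2) ≤
        4 * (Real.sinh (δU / 2) ^ 2 + 1) * Real.exp 1 * cR ^ 2 * (4 * Real.cosh (b / 2) ^ 2 * (1 + b) ^ 2 / b ^ 2) := by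
      have : 0 ≤ Real.exp 1 * cR ^ 2 * (4 * Real.cosh (b / 2) ^ 2 * (1 + b) ^ 2 / b ^ 2) := by positivity
      nlinarith only [hsinh, this]
    refine le_trans (mul_le_mul_of_nonneg_left (mul_le_mul hfac1 (add_le_add hnear hfar) hBR0 (by positivity))
      (by norm_num : (0 : ℝ) ≤ 2)) (le_of_eq ?_)
    ring
  -- gain ≥ c_∞² · explicit
  have hgain : cR ^ 2 * ((δL - 3 * r) / 2 * (κ ^ 2 / (4 * b ^ 2)) * dodgerPhi (9 * y ^ 2 / 64) ^ 2) ≤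
      dodgerGainBound b T' (δ - r) r (1 - ηU - 3 * τ1 - τ2U) := by
    unfold dodgerGainBound
    rw [← hcR, ← hκdef, ← hpdef]
    have hΦ : dodgerPhi (9 * y ^ 2 / 64) ≤ dodgerPhi (p * (3 * (2 * (δ - r) - 4 * r) / 8) ^ 2) := by
      refine dodgerPhi_le_dodgerPhi (by positivity) ?_
      have h1 : 9 * y ^ 2 / 64 = p * (3 * δ / 8) ^ 2 := by rw [← hpδ]; ring
      rw [h1]
      refine mul_le_mul_of_nonneg_left (pow_le_pow_left₀ (by positivity) (by linarith only [hr6, hδLδ]) 2) hp0.le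
    have hΦ0 : 0 ≤ dodgerPhi (9 * y ^ 2 / 64) := (dodgerPhi_pos (by positivity)).le
    have hA : 0 ≤ κ * (1 / (2 * b) * cR) * dodgerPhi (9 * y ^ 2 / 64) := by positivity
    calc cR ^ 2 * ((δL - 3 * r) / 2 * (κ ^ 2 / (4 * b ^ 2)) * dodgerPhi (9 * y ^ 2 / 64) ^ 2)
        = (δL - 3 * r) / 2 * (κ * (1 / (2 * b) * cR) * dodgerPhi (9 * y ^ 2 / 64)) ^ 2 := by ring
      _ ≤ (2 * (δ - r) - 4 * r) / 4 * (κ * (1 / (2 * b) * cR) * dodgerPhi (p * (3 * (2 * (δ - r) - 4 * r) / 8) ^ 2)) ^ 2 := by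
          refine mul_le_mul (by linarith only [hδLδ]) (pow_le_pow_left₀ hA (mul_le_mul_of_nonneg_left hΦ (by positivity)) 2)
            (pow_nonneg hA 2) (by linarith only [hr6, hδLδ, hr0])
  have hlog0 : 0 ≤ Real.log q := by linarith only [hbq1, hb, hr0]
  have hfac : 0 ≤ 2 * Real.log q / Real.sqrt q := by positivity
  have hlt' : dodgerCostBound b T' δ c <
      2 * Real.log q / Real.sqrt q * dodgerGainBound b T' (δ - r) r (1 - ηU - 3 * τ1 - τ2U) := by
    have h2 := mul_lt_mul_of_pos_left hlt (pow_pos hcR0 2)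
    refine lt_of_le_of_lt hcost (lt_of_lt_of_le h2 ?_)
    calc cR ^ 2 * (2 * Real.log q / Real.sqrt q * ((δL - 3 * r) / 2 * (κ ^ 2 / (4 * b ^ 2)) * dodgerPhi (9 * y ^ 2 / 64) ^ 2))
        = 2 * Real.log q / Real.sqrt q * (cR ^ 2 * ((δL - 3 * r) / 2 * (κ ^ 2 / (4 * b ^ 2)) * dodgerPhi (9 * y ^ 2 / 64) ^ 2)) := by
          ring
      _ ≤ 2 * Real.log q / Real.sqrt q * dodgerGainBound b T' (δ - r) r (1 - ηU - 3 * τ1 - τ2U) :=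
          mul_le_mul_of_nonneg_left hgain hfac
  -- (10) the witness: restore the values and apply `dodger_witness`
  subst hN₂ hδ hcdef hpdef hKdef hT' hr
  subst hW
  exact dodger_witness (q := q) (q' := q') (C := C) n hbq1 hbq2 hb0 (by linarith only [hT'3]) hK1 hKle hDc.continuousOn
    (fun t _ => hD0 t) hΔ hc64 hgen hp0 hδb' hεδ hN12 hWN hX hη hlam hρ1' hρ11 hρ2 hρ2U1 hτ1' hτ2 hκ' hδC' hwin' hlt'

end Summit.RiemannHypothesis.RiemannHypothesis.Theorems.Handoff

end
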